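import Summits.AtomisticToContinuum.FouriersLaw.Theorems.LatticeLandauDampingAbelThermodynamicLimitFixedFrequencyMatchingAutocorrBound
import HarnessLib

/-!
# `stub_fixedTimeMatching` of line `series-law-at-every-laplace-frequency`, part 1:
the two ANCHOR-UNIFORM dynamical leaves, shared with the sibling line
(crux `LatticeLandauDamping.AbelThermodynamicLimit`, item stmt-AtomisticToContinuum-14013, `Iff.rfl`-identical
to `EmbeddedDrudeMourre.AbelThermodynamicLimit`, stmt-AtomisticToContinuum-12596; `--supports` helper file
proving the registered reduction stub `stub_anchoredCorrelationTailsOfUniform`, closes nothing)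

The registered stub `stub_fixedTimeMatching` (`H_time`, the residual of S3 `stub_fixedFrequencyMatching`
after `stub_fixedFrequencyMatchingOfFixedTime`) asks, for the OPEN pinned anharmonic chain
`P = pinnedChain ω₂ lam β γ` (all `> 0`, both Langevin baths at `T > 0`) and a regular witness `(μT, D)`,
that the per-length equilibrium autocorrelation of the total bond current converges at a.e. fixed time:
`c_N(t)/N → C_T(t) = D.currentCorrelation μT t`, `c_N(t) = Σ_i Σ_k K_N(i,k,t)`,
`K_N(i,k,t) = ⟨j_i(0) j_k(t)⟩_{N,T} = ∫ j_i · (P_t j_k) dμ_{N,T}`.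

The bond average needs the two DYNAMICAL LEAVES of the sibling line `loomis-compact-horizon-witness`
(there anchored at the central bond `c_N = ⌊(N-1)/2⌋`: (C) `stub_anchoredCorrelationTails`,
(B₀) `stub_fixedTimeOffsetMatching`) UNIFORMLY OVER BULK ANCHORS. This file states the anchor-uniform
leaves — registered on this item as

* (C′) `stub_uniformAnchoredCorrelationTails`: for every `τ > 0`, `ε > 0` there are `R`, `N₀` with
  `Σ_{|k-i|>R} |K_N(i,k,t)| ≤ ε` for all `N ≥ N₀`, all `R`-deep anchors `i` (`R ≤ i`, `i + R < N`) and all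
  `t ∈ [0, τ]` (light cone of the open chain at fixed time; only the chain parameters and `T` enter);
* (B′) `stub_uniformFixedTimeOffsetMatching`: under the hypotheses of `H_time` (regular DLR uniqueness at
  `T`, a regular witness `(μT, D)`), for every offset `x`, `t > 0`, `ε > 0` there are `L`, `N₀` with
  `|K_N(i, i+x, t) - ∫ j_0 · (j_x ∘ φ_t) dμT| ≤ ε` for all `N ≥ N₀` and all `L`-deep anchors `i`
  (two-dynamics coupling on bulk windows + convergence of the bulk window laws of `gibbsMeasure N T` to
  the unique regular DLR state) —

and proves (sorry-free) that they contain the sibling's leaves BY TEXT: (C′) ⟹ (C)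
(`stub_anchoredCorrelationTailsOfUniform`: the central bond is `R`-deep once `N ≥ 2R + 1`) and
(B′) ⟹ (B₀) (`fixedTimeOffsetMatching_of_uniformFixedTimeOffsetMatching`: `ε/2` at the central anchor,
`N ≥ 2L + 2|x| + 2`).
So ONE future proof of (C′) and (B′) serves both cruxes: this item's `H_time` (part 2,
`stub_fixedTimeMatchingOfRegisteredLeaves`, via the bond average `tendsto_totalCurrentAutocorr_div_of_uniformLeaves`)
and the sibling's S4 (`stub_fixedHorizonMatchingOfDynamicalLeaves`). (C′) at fixed `t > 0` is the
hypothesis `hC` and (B′) at the witness is the hypothesis `hB` of `stub_fixedTimeMatchingOfUniformLeaves`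
(`uniformAnchoredCorrelationTails_pointwise`). Neither leaf is in the tree.
References: Bonetto–Lebowitz–Rey-Bellet 2000 §7; Buttà–Marchioro 2016; Kundu–Dhar–Narayan 2009.
-/

noncomputable section

open MeasureTheory ProbabilityTheory Filter Topology Set Function
open scoped NNReal ENNReal

namespace Summit.AtomisticToContinuum.FouriersLaw.Theorems.AbelThermodynamicLimit.SeriesLawAtEveryLaplaceFrequency

open Literature.MathematicalPhysics.KineticTheory.HeatConduction
open Literature.MathematicalPhysics.KineticTheory OscillatorChain

/-! ## §1 (C′) at a fixed time -/

/-- **(C′) at a fixed time.** The `τ`-uniform anchor-uniform tails (C′) at one parameter point give, at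
every fixed `t ≥ 0`, the pointwise form used by the bond average (hypothesis `hC` of
`stub_fixedTimeMatchingOfUniformLeaves`, take `τ = max t 1`). [folklore] -/
theorem uniformAnchoredCorrelationTails_pointwise {ω₂ lam β γ T : ℝ}
    (hC : ∀ τ : ℝ, 0 < τ → ∀ ε : ℝ, 0 < ε → ∃ R N₀ : ℕ, ∀ N : ℕ, N₀ ≤ N → ∀ i : Fin N,
      R ≤ i.val → i.val + R < N → ∀ t ∈ Set.Icc (0 : ℝ) τ,
        (∑ k : Fin N, if i.val ≤ k.val + R ∧ k.val ≤ i.val + R then (0 : ℝ) else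
          |∫ z, (pinnedChain ω₂ lam β γ).bondCurrent N i z *
              (∫ y, (pinnedChain ω₂ lam β γ).bondCurrent N k y
                ∂((pinnedChain ω₂ lam β γ).transitionKernel N T T t.toNNReal z))
            ∂((pinnedChain ω₂ lam β γ).gibbsMeasure N T)|) ≤ ε)
    {t : ℝ} (ht : 0 ≤ t) :
    ∀ ε : ℝ, 0 < ε → ∃ R N₀ : ℕ, ∀ N : ℕ, N₀ ≤ N → ∀ i : Fin N, R ≤ i.val → i.val + R < N →
      (∑ k : Fin N, if i.val ≤ k.val + R ∧ k.val ≤ i.val + R then (0 : ℝ) else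
        |∫ z, (pinnedChain ω₂ lam β γ).bondCurrent N i z *
            (∫ y, (pinnedChain ω₂ lam β γ).bondCurrent N k y
              ∂((pinnedChain ω₂ lam β γ).transitionKernel N T T t.toNNReal z))
          ∂((pinnedChain ω₂ lam β γ).gibbsMeasure N T)|) ≤ ε := by
  intro ε hε
  obtain ⟨R, N₀, h⟩ := hC (max t 1) (lt_of_lt_of_le one_pos (le_max_right _ _)) ε hε
  exact ⟨R, N₀, fun N hN i h1 h2 => h N hN i h1 h2 t ⟨ht, le_max_left _ _⟩⟩

/-! ## §2 (C′) contains the sibling's central-anchor leaf (C) -/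

/-- **Registered reduction stub `stub_anchoredCorrelationTailsOfUniform` — (C′) ⟹ (C).** The
anchor-uniform correlation tails (C′, registered leaf `stub_uniformAnchoredCorrelationTails` of this
item) imply VERBATIM the central-anchor tails (C) of the sibling line (registered leaf
`stub_anchoredCorrelationTails` of item stmt-AtomisticToContinuum-12596): the central bond
`c_N = ⌊(N-1)/2⌋` is `R`-deep as soon as `N ≥ 2R + 1`, and the two window predicates coincide. [folklore] -/
theorem stub_anchoredCorrelationTailsOfUniform :
    (∀ ω₂ lam β γ : ℝ, 0 < ω₂ → 0 < lam → 0 < β → 0 < γ → ∀ T : ℝ, 0 < T →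
      ∀ τ : ℝ, 0 < τ → ∀ ε : ℝ, 0 < ε → ∃ R N₀ : ℕ, ∀ N : ℕ, N₀ ≤ N → ∀ i : Fin N,
        R ≤ i.val → i.val + R < N → ∀ t ∈ Set.Icc (0 : ℝ) τ,
          (∑ k : Fin N, if i.val ≤ k.val + R ∧ k.val ≤ i.val + R then (0 : ℝ) else
            |∫ z, (Literature.MathematicalPhysics.KineticTheory.HeatConduction.pinnedChain
                    ω₂ lam β γ).bondCurrent N i z *
                (∫ y, (Literature.MathematicalPhysics.KineticTheory.HeatConduction.pinnedChain
                    ω₂ lam β γ).bondCurrent N k y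
                  ∂((Literature.MathematicalPhysics.KineticTheory.HeatConduction.pinnedChain
                    ω₂ lam β γ).transitionKernel N T T t.toNNReal z))
              ∂((Literature.MathematicalPhysics.KineticTheory.HeatConduction.pinnedChain
                    ω₂ lam β γ).gibbsMeasure N T)|) ≤ ε) →
    ∀ ω₂ lam β γ : ℝ, 0 < ω₂ → 0 < lam → 0 < β → 0 < γ → ∀ T : ℝ, 0 < T → ∀ τ : ℝ, 0 < τ →
      ∀ ε : ℝ, 0 < ε → ∃ R : ℕ, ∃ N₀ : ℕ, ∀ N : ℕ, N₀ ≤ N → ∀ hN : 2 ≤ N,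
        ∀ t ∈ Set.Icc (0 : ℝ) τ,
          (∑ k : Fin N, if (N - 1) / 2 ≤ k.val + R ∧ k.val ≤ (N - 1) / 2 + R then (0 : ℝ) else
            |∫ z, (Literature.MathematicalPhysics.KineticTheory.HeatConduction.pinnedChain
                      ω₂ lam β γ).bondCurrent N ⟨(N - 1) / 2, by omega⟩ z *
                (∫ y, (Literature.MathematicalPhysics.KineticTheory.HeatConduction.pinnedChain
                      ω₂ lam β γ).bondCurrent N k y
                  ∂((Literature.MathematicalPhysics.KineticTheory.HeatConduction.pinnedChain
                      ω₂ lam β γ).transitionKernel N T T t.toNNReal z))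
              ∂((Literature.MathematicalPhysics.KineticTheory.HeatConduction.pinnedChain
                      ω₂ lam β γ).gibbsMeasure N T)|) ≤ ε := by
  intro hC ω₂ lam β γ hω hl hβ hγ T hT τ hτ ε hε
  obtain ⟨R, N₀, h⟩ := hC ω₂ lam β γ hω hl hβ hγ T hT τ hτ ε hε
  refine ⟨R, max N₀ (2 * R + 1), fun N hN h2 t ht => ?_⟩
  have hN₀ : N₀ ≤ N := le_trans (le_max_left _ _) hN
  have hNR : 2 * R + 1 ≤ N := le_trans (le_max_right _ _) hN
  exact h N hN₀ ⟨(N - 1) / 2, by omega⟩ (by simp only; omega) (by simp only; omega) t ht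

/-! ## §3 (B′) contains the sibling's central-anchor leaf (B₀) -/

/-- **(B′) ⟹ (B₀).** The anchor-uniform per-offset fixed-time matching (B′, registered leaf
`stub_uniformFixedTimeOffsetMatching` of this item, verbatim as the hypothesis) implies VERBATIM the
central-anchor per-offset matching (B₀) of the sibling line
(registered leaf `stub_fixedTimeOffsetMatching` of item stmt-AtomisticToContinuum-12596): for
`N ≥ max N₀ (2L + 2|x| + 2)` the central bond `c_N` is `L`-deep and `c_N + x` is a bond, so the
`dite` is the genuine pair correlation, within `ε/2 < ε` of the witness's offset correlation. [folklore] -/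
theorem fixedTimeOffsetMatching_of_uniformFixedTimeOffsetMatching :
    (∀ ω₂ lam β γ : ℝ, 0 < ω₂ → 0 < lam → 0 < β → 0 < γ → ∀ T : ℝ, 0 < T →
      (∀ μ₁ μ₂ : MeasureTheory.Measure
            Literature.MathematicalPhysics.KineticTheory.HeatConduction.ChainConfig,
          (Literature.MathematicalPhysics.KineticTheory.HeatConduction.pinnedChain
                ω₂ lam β γ).IsChainGibbsMeasure T μ₁ →
          Literature.MathematicalPhysics.KineticTheory.HeatConduction.IsShiftInvariant μ₁ →
          (Literature.MathematicalPhysics.KineticTheory.HeatConduction.pinnedChain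
                ω₂ lam β γ).HasSuperstabilityEstimate μ₁ →
          (Literature.MathematicalPhysics.KineticTheory.HeatConduction.pinnedChain
                ω₂ lam β γ).IsChainGibbsMeasure T μ₂ →
          Literature.MathematicalPhysics.KineticTheory.HeatConduction.IsShiftInvariant μ₂ →
          (Literature.MathematicalPhysics.KineticTheory.HeatConduction.pinnedChain
                ω₂ lam β γ).HasSuperstabilityEstimate μ₂ → μ₁ = μ₂) →
      ∀ (μT : MeasureTheory.Measure
            Literature.MathematicalPhysics.KineticTheory.HeatConduction.ChainConfig)
        (D : Literature.MathematicalPhysics.KineticTheory.HeatConduction.InfiniteChainDynamics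
          (Literature.MathematicalPhysics.KineticTheory.HeatConduction.pinnedChain ω₂ lam β γ)),
        (Literature.MathematicalPhysics.KineticTheory.HeatConduction.pinnedChain
            ω₂ lam β γ).IsChainGibbsMeasure T μT →
        Literature.MathematicalPhysics.KineticTheory.HeatConduction.IsShiftInvariant μT →
        (Literature.MathematicalPhysics.KineticTheory.HeatConduction.pinnedChain
            ω₂ lam β γ).HasSuperstabilityEstimate μT →
        D.carrier ⊆ (Literature.MathematicalPhysics.KineticTheory.HeatConduction.pinnedChain
            ω₂ lam β γ).bmGood →
        D.PreservesMeasure μT →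
        (∀ t : ℝ, D.HasAbsConvergentCorrelation μT t) →
        ∀ (x : ℤ) (t : ℝ), 0 < t → ∀ ε : ℝ, 0 < ε → ∃ L N₀ : ℕ, ∀ N : ℕ, N₀ ≤ N → ∀ i k : Fin N,
          L ≤ i.val → i.val + L < N → (k.val : ℤ) = i.val + x →
          |(∫ z, (Literature.MathematicalPhysics.KineticTheory.HeatConduction.pinnedChain
                    ω₂ lam β γ).bondCurrent N i z *
              (∫ y, (Literature.MathematicalPhysics.KineticTheory.HeatConduction.pinnedChain
                    ω₂ lam β γ).bondCurrent N k y
                ∂((Literature.MathematicalPhysics.KineticTheory.HeatConduction.pinnedChain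
                    ω₂ lam β γ).transitionKernel N T T t.toNNReal z))
              ∂((Literature.MathematicalPhysics.KineticTheory.HeatConduction.pinnedChain
                    ω₂ lam β γ).gibbsMeasure N T)) -
            ∫ σ, (Literature.MathematicalPhysics.KineticTheory.HeatConduction.pinnedChain
                    ω₂ lam β γ).bondCurrentZ σ 0 *
              (Literature.MathematicalPhysics.KineticTheory.HeatConduction.pinnedChain
                    ω₂ lam β γ).bondCurrentZ (D.flow t σ) x ∂μT| ≤ ε) →
    ∀ ω₂ lam β γ : ℝ, 0 < ω₂ → 0 < lam → 0 < β → 0 < γ → ∀ T : ℝ, 0 < T →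
      (∀ μ₁ μ₂ : MeasureTheory.Measure
            Literature.MathematicalPhysics.KineticTheory.HeatConduction.ChainConfig,
          (Literature.MathematicalPhysics.KineticTheory.HeatConduction.pinnedChain
                ω₂ lam β γ).IsChainGibbsMeasure T μ₁ →
          Literature.MathematicalPhysics.KineticTheory.HeatConduction.IsShiftInvariant μ₁ →
          (Literature.MathematicalPhysics.KineticTheory.HeatConduction.pinnedChain
                ω₂ lam β γ).HasSuperstabilityEstimate μ₁ →
          (Literature.MathematicalPhysics.KineticTheory.HeatConduction.pinnedChain
                ω₂ lam β γ).IsChainGibbsMeasure T μ₂ →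
          Literature.MathematicalPhysics.KineticTheory.HeatConduction.IsShiftInvariant μ₂ →
          (Literature.MathematicalPhysics.KineticTheory.HeatConduction.pinnedChain
                ω₂ lam β γ).HasSuperstabilityEstimate μ₂ → μ₁ = μ₂) →
      ∀ (μT : MeasureTheory.Measure
            Literature.MathematicalPhysics.KineticTheory.HeatConduction.ChainConfig)
        (D : Literature.MathematicalPhysics.KineticTheory.HeatConduction.InfiniteChainDynamics
          (Literature.MathematicalPhysics.KineticTheory.HeatConduction.pinnedChain ω₂ lam β γ)),
        (Literature.MathematicalPhysics.KineticTheory.HeatConduction.pinnedChain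
            ω₂ lam β γ).IsChainGibbsMeasure T μT →
        Literature.MathematicalPhysics.KineticTheory.HeatConduction.IsShiftInvariant μT →
        (Literature.MathematicalPhysics.KineticTheory.HeatConduction.pinnedChain
            ω₂ lam β γ).HasSuperstabilityEstimate μT →
        D.carrier ⊆ (Literature.MathematicalPhysics.KineticTheory.HeatConduction.pinnedChain
            ω₂ lam β γ).bmGood →
        D.PreservesMeasure μT →
        (∀ t : ℝ, D.HasAbsConvergentCorrelation μT t) →
        ∀ (x : ℤ) (t : ℝ), 0 < t →
          Filter.Tendsto (fun N : ℕ =>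
              if hN : 2 * x.natAbs + 2 ≤ N then
                ∫ z, (Literature.MathematicalPhysics.KineticTheory.HeatConduction.pinnedChain
                        ω₂ lam β γ).bondCurrent N ⟨(N - 1) / 2, by omega⟩ z *
                  (∫ y, (Literature.MathematicalPhysics.KineticTheory.HeatConduction.pinnedChain
                        ω₂ lam β γ).bondCurrent N ⟨((((N - 1) / 2 : ℕ) : ℤ) + x).toNat, by omega⟩ y
                    ∂((Literature.MathematicalPhysics.KineticTheory.HeatConduction.pinnedChain
                        ω₂ lam β γ).transitionKernel N T T t.toNNReal z))
                  ∂((Literature.MathematicalPhysics.KineticTheory.HeatConduction.pinnedChain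
                        ω₂ lam β γ).gibbsMeasure N T)
              else 0)
            Filter.atTop
            (nhds (∫ σ, (Literature.MathematicalPhysics.KineticTheory.HeatConduction.pinnedChain
                      ω₂ lam β γ).bondCurrentZ σ 0 *
              (Literature.MathematicalPhysics.KineticTheory.HeatConduction.pinnedChain
                      ω₂ lam β γ).bondCurrentZ (D.flow t σ) x ∂μT)) := by
  intro hB ω₂ lam β γ hω hl hβ hγ T hT hU μT D hG hS hss hcar hPres hAC x t ht
  rw [Metric.tendsto_atTop]
  intro ε hε
  obtain ⟨L, N₀, h⟩ := hB ω₂ lam β γ hω hl hβ hγ T hT hU μT D hG hS hss hcar hPres hAC x t ht (ε / 2)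
    (half_pos hε)
  refine ⟨max N₀ (2 * L + 2 * x.natAbs + 2), fun N hN => ?_⟩
  have hN₀ : N₀ ≤ N := le_trans (le_max_left _ _) hN
  have hNL : 2 * L + 2 * x.natAbs + 2 ≤ N := le_trans (le_max_right _ _) hN
  have h2 : 2 * x.natAbs + 2 ≤ N := by omega
  rw [dif_pos h2, Real.dist_eq]
  have key := h N hN₀ ⟨(N - 1) / 2, by omega⟩ ⟨((((N - 1) / 2 : ℕ) : ℤ) + x).toNat, by omega⟩
    (by simp only; omega) (by simp only; omega) (by simp only; omega)
  linarith

end Summit.AtomisticToContinuum.FouriersLaw.Theorems.AbelThermodynamicLimit.SeriesLawAtEveryLaplaceFrequency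

end
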